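import Literature.AlgebraicGeometry.Frobenioids.PadicValueGroupification
import Literature.AlgebraicGeometry.Frobenioids.MonoidRealification
import Literature.AlgebraicGeometry.Frobenioids.ModelFrobenioid
import HarnessLib

/-!
# Frobenioids II, Example 1.1 (i): the monoids `Φ₀`, `B₀` and `B₀ → Φ₀^gp` as functors; the Frobenioid `C₀`

Mochizuki, *The geometry of Frobenioids II*, Kyushu J. Math. **62** (2008) 401–460, §1 Example 1.1 (i),
author's text p. 7 [cite: MochizukiFrdII2008, Ex 1.1 (i) p.7]: "the assignment
`Spec(K) ↦ ord(O_K^⊳)^rlf (≅ ℝ_{≥0})` determines a monoid `Φ₀` on `D₀` … the assignment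
`Spec(K) ↦ K^×` determines a group-like monoid `B₀` on `D₀` together with a natural homomorphism of
monoids `B₀ → Φ₀^gp` … Thus, by [FrdI], Theorem 5.2, (ii), this data determines a [model] Frobenioid `C₀`."

**What is constructed (no named facts).** Over the category `PadicFld p` of valued fields in which `p`
is a nonzero non-unit integer (morphisms `Spec K → Spec L` = valuative ring homomorphisms `L → K`; the
finite extensions of `ℚ_p` with their `p`-adic valuations are the objects in print), we build
* `phiZero : (PadicFld p)ᵒᵖ ⥤ CommMonCat`, `Spec K ↦ ord(O_K^⊳) ⊗ ℝ_{≥0}` (the fibre monoids of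
  `PadicValueMonoids.lean` realified by `Realification` of `MonoidRealification.lean`), with the
  functor laws PROVED;
* `bZero : (PadicFld p)ᵒᵖ ⥤ CommMonCat`, `Spec K ↦ K^×`;
* `divZero : bZero ⟶ monoidGp phiZero`, objectwise `K^× → ord(O_K^⊳)^gp → (ord(O_K^⊳) ⊗ ℝ_{≥0})^gp`
  (`divUnits` of `PadicValueGroupification.lean`), NATURALITY PROVED;
* `CZero p := ModelFrobenioid phiZero bZero divZero` — the category `C₀` of Example 1.1 (i) via the
  model-Frobenioid construction of [FrdI] Thm. 5.2 (i) (`ModelFrobenioid.lean`).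
That `C₀` IS a Frobenioid of rationally standard type etc. is [FrdI] Thm. 5.2 (ii)/(iii) + FrdII
Thm. 1.2 (typed elsewhere); here only the data and the category are constructed.
-/

namespace Literature.AlgebraicGeometry.Frobenioids

open scoped ValuativeRel
open CategoryTheory Opposite ValuativeRel Function

universe u

namespace PadicFrd

/-! ### The base category of `p`-adic valued fields -/

/-- An object `Spec K` of the base: a valued field `K` in which `p` is a nonzero integer of valuation
`< 1` (FrdII Ex. 1.1 (i), p. 7: "`K` is a finite extension of `ℚ_p`" — those are the objects in print).
[cite: MochizukiFrdII2008, Ex 1.1 (i) p.7] -/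
structure PadicFld (p : ℕ) : Type (u + 1) where
  /-- the field `K` -/
  K : Type u
  [field : Field K]
  [val : ValuativeRel K]
  /-- `p ∈ O_K^⊳` -/
  p_mem : ((p : ℕ) : K) ∈ intNonzero K
  /-- `p` is not a unit of `O_K`: `v(p) < 1` -/
  p_lt : valuation K ((p : ℕ) : K) < 1

namespace PadicFld

attribute [instance] PadicFld.field PadicFld.val

variable {p : ℕ}

/-- A morphism `Spec K → Spec L` of the base: a valuative ring homomorphism `L → K` (one along which
`O_L = O_K ∩ L`, as for the inclusions of finite extensions of `ℚ_p`). [cite: MochizukiFrdII2008, Ex 1.1 (i) p.7] -/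
@[ext] structure Hom (X Y : PadicFld.{u} p) : Type u where
  /-- the underlying ring homomorphism, in the opposite direction -/
  alg : Y.K →+* X.K
  /-- it is valuative -/
  isValHom : IsValHom alg

/-- Composites of valuative homomorphisms are valuative. [cite: MochizukiFrdII2008, Ex 1.1 (i) p.7] -/
theorem isValHom_comp {X Y Z : PadicFld.{u} p} (f : Hom X Y) (g : Hom Y Z) :
    IsValHom (f.alg.comp g.alg) := fun a b => (f.isValHom _ _).trans (g.isValHom a b)

/-- The base category (composition = composition of ring homomorphisms, reversed).
[cite: MochizukiFrdII2008, Ex 1.1 (i) p.7] -/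
instance instCategory : Category (PadicFld.{u} p) where
  Hom := Hom
  id X := ⟨RingHom.id X.K, fun _ _ => Iff.rfl⟩
  comp f g := ⟨f.alg.comp g.alg, isValHom_comp f g⟩

/-- Extensionality of morphisms. [cite: MochizukiFrdII2008, Ex 1.1 (i) p.7] -/
@[ext] theorem hom_ext {X Y : PadicFld.{u} p} {f g : X ⟶ Y} (h : f.alg = g.alg) : f = g := Hom.ext h

/-- The ring homomorphism of a composite. [cite: MochizukiFrdII2008, Ex 1.1 (i) p.7] -/
@[simp] theorem comp_alg {X Y Z : PadicFld.{u} p} (f : X ⟶ Y) (g : Y ⟶ Z) :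
    (f ≫ g).alg = f.alg.comp g.alg := rfl

/-- The ring homomorphism of the identity. [cite: MochizukiFrdII2008, Ex 1.1 (i) p.7] -/
@[simp] theorem id_alg (X : PadicFld.{u} p) : (𝟙 X : X ⟶ X).alg = RingHom.id X.K := rfl

end PadicFld

/-! ### Functoriality lemmas for `ordIntMapOfHom` and `Realification.map` -/

section Lemmas

variable {K : Type u} [Field K] [ValuativeRel K] {L : Type u} [Field L] [ValuativeRel L]
  {E : Type u} [Field E] [ValuativeRel E]

/-- `ordIntMapOfHom` of the identity is the identity. [cite: MochizukiFrdII2008, Ex 1.1 (i) p.7] -/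
theorem ordIntMapOfHom_id (h : IsValHom (RingHom.id K)) : ordIntMapOfHom (RingHom.id K) h = MonoidHom.id _ := by
  ext a
  obtain ⟨x, rfl⟩ := Associates.mk_surjective a
  rw [ordIntMapOfHom_mk, MonoidHom.id_apply]
  exact congrArg Associates.mk (Subtype.ext rfl)

/-- `ordIntMapOfHom` of a composite. [cite: MochizukiFrdII2008, Ex 1.1 (i) p.7] -/
theorem ordIntMapOfHom_comp (σ : L →+* K) (hσ : IsValHom σ) (τ : E →+* L) (hτ : IsValHom τ)
    (h : IsValHom (σ.comp τ)) :
    ordIntMapOfHom (σ.comp τ) h = (ordIntMapOfHom σ hσ).comp (ordIntMapOfHom τ hτ) := by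
  ext a
  obtain ⟨x, rfl⟩ := Associates.mk_surjective a
  rw [MonoidHom.comp_apply, ordIntMapOfHom_mk, ordIntMapOfHom_mk, ordIntMapOfHom_mk]
  exact congrArg Associates.mk (Subtype.ext rfl)

variable {M N P : Type u} [CommMonoid M] [CommMonoid N] [CommMonoid P]

/-- `Realification.map` of the identity. [cite: MochizukiFrdI2008, §0 p.10] -/
theorem realificationMap_id : Realification.map (MonoidHom.id M) = MonoidHom.id _ :=
  MonoidHom.ext fun F => by
    change (show RDual (RDual M) from Realification.map (MonoidHom.id M) F) =
      (show RDual (RDual M) from F)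
    refine MonoidHom.ext fun g => ?_
    change (show RDual (RDual M) from F) (g.comp (MonoidHom.id M)) = _
    rw [MonoidHom.comp_id]

/-- `Realification.map` of a composite. [cite: MochizukiFrdI2008, §0 p.10] -/
theorem realificationMap_comp (ψ : N →* P) (φ : M →* N) :
    Realification.map (ψ.comp φ) = (Realification.map ψ).comp (Realification.map φ) :=
  MonoidHom.ext fun F => by
    change (show RDual (RDual P) from Realification.map (ψ.comp φ) F) =
      (show RDual (RDual P) from (Realification.map ψ) (Realification.map φ F))
    refine MonoidHom.ext fun g => ?_
    change (show RDual (RDual M) from F) (g.comp (ψ.comp φ)) =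
      (show RDual (RDual M) from F) ((g.comp ψ).comp φ)
    rw [MonoidHom.comp_assoc]

end Lemmas

/-! ### The functors `Φ₀`, `B₀` and the transformation `B₀ → Φ₀^gp` -/

section Functors

variable (p : ℕ)

/-- **Example 1.1 (i)** (FrdII p. 7): "the assignment `Spec(K) ↦ ord(O_K^⊳)^rlf` … determines a monoid
`Φ₀` on `D₀`" — as a functor `D₀ᵒᵖ → CommMon`, `Spec K ↦ ord(O_K^⊳) ⊗ ℝ_{≥0}`, an arrow
`Spec K → Spec L` (i.e. `σ : L → K`) going to the realification of `ord(O_L^⊳) → ord(O_K^⊳)`.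
[cite: MochizukiFrdII2008, Ex 1.1 (i) p.7] -/
noncomputable def phiZero : (PadicFld.{u} p)ᵒᵖ ⥤ CommMonCat.{u} where
  obj X := CommMonCat.of (Realification (OrdInt X.unop.K))
  map {X Y} f := CommMonCat.ofHom (Realification.map (ordIntMapOfHom f.unop.alg f.unop.isValHom))
  map_id X := by
    apply CommMonCat.hom_ext
    rw [CommMonCat.hom_ofHom, CommMonCat.hom_id]
    change Realification.map (ordIntMapOfHom (RingHom.id X.unop.K) _) = _
    rw [ordIntMapOfHom_id, realificationMap_id]
  map_comp {X Y Z} f g := by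
    apply CommMonCat.hom_ext
    rw [CommMonCat.hom_ofHom, CommMonCat.hom_comp, CommMonCat.hom_ofHom, CommMonCat.hom_ofHom]
    change Realification.map (ordIntMapOfHom (g.unop.alg.comp f.unop.alg) _) = _
    rw [ordIntMapOfHom_comp g.unop.alg g.unop.isValHom f.unop.alg f.unop.isValHom, realificationMap_comp]

/-- **Example 1.1 (i)** (FrdII p. 7): "the assignment `Spec(K) ↦ K^×` determines a group-like monoid
`B₀` on `D₀`". [cite: MochizukiFrdII2008, Ex 1.1 (i) p.7] -/
noncomputable def bZero : (PadicFld.{u} p)ᵒᵖ ⥤ CommMonCat.{u} where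
  obj X := CommMonCat.of (X.unop.K)ˣ
  map {X Y} f := CommMonCat.ofHom (Units.map (f.unop.alg : X.unop.K →* Y.unop.K))
  map_id X := by
    apply CommMonCat.hom_ext
    rw [CommMonCat.hom_ofHom, CommMonCat.hom_id]
    exact Units.map_id _
  map_comp {X Y Z} f g := by
    apply CommMonCat.hom_ext
    rw [CommMonCat.hom_ofHom, CommMonCat.hom_comp, CommMonCat.hom_ofHom, CommMonCat.hom_ofHom]
    exact Units.map_comp _ _

/-- The component of `B₀ → Φ₀^gp` at `Spec K`: `K^× → ord(O_K^⊳)^gp → (ord(O_K^⊳) ⊗ ℝ_{≥0})^gp`.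
[cite: MochizukiFrdII2008, Ex 1.1 (i) p.7] -/
noncomputable def divZeroHom (K : Type u) [Field K] [ValuativeRel K] :
    Kˣ →* Algebra.GrothendieckGroup (Realification (OrdInt K)) :=
  (MonGp.map (Realification.of (OrdInt K))).comp (divUnits K)

/-- On integers: `divZeroHom x = [x] ⊗ 1`, the image of the class of `x ∈ O_K^⊳`.
[cite: MochizukiFrdII2008, Ex 1.1 (i) p.7] -/
theorem divZeroHom_intNonzeroToUnits (K : Type u) [Field K] [ValuativeRel K] (x : intNonzero K) :
    divZeroHom K (intNonzeroToUnits K x) =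
      Algebra.GrothendieckGroup.of (Realification.of (OrdInt K) (Associates.mk x)) := by
  rw [divZeroHom, MonoidHom.comp_apply, divUnits_intNonzeroToUnits, MonGp.map_of]

/-- The two ways round the naturality square agree on `ord(O_L^⊳)^gp` (checked on generators).
[cite: MochizukiFrdII2008, Ex 1.1 (i) p.7] -/
theorem realification_gp_square {K L : Type u} [Field K] [ValuativeRel K] [Field L] [ValuativeRel L]
    (σ : L →+* K) (hσ : IsValHom σ) :
    (MonGp.map (Realification.of (OrdInt K))).comp (gpMapOfHom σ hσ) =
      (MonGp.map (Realification.map (ordIntMapOfHom σ hσ))).comp (MonGp.map (Realification.of (OrdInt L))) :=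
  MonGp.hom_ext fun a => by
    rw [MonoidHom.comp_apply, MonoidHom.comp_apply, gpMapOfHom_of, MonGp.map_of, MonGp.map_of,
      MonGp.map_of, Realification.map_of]

/-- **Example 1.1 (i)** (FrdII p. 7): "a natural homomorphism of monoids `B₀ → Φ₀^gp` [i.e., by
considering the natural surjection `K^× ↠ ord(K^×)`]" — the natural transformation, NATURALITY PROVED.
[cite: MochizukiFrdII2008, Ex 1.1 (i) p.7] -/
noncomputable def divZero : bZero p ⟶ monoidGp (phiZero p) where
  app X := CommMonCat.ofHom (divZeroHom X.unop.K)
  naturality {X Y} f := by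
    apply CommMonCat.hom_ext
    refine MonoidHom.ext fun x => ?_
    change divZeroHom Y.unop.K (Units.map (f.unop.alg : X.unop.K →* Y.unop.K) x) =
      MonGp.map (Realification.map (ordIntMapOfHom f.unop.alg f.unop.isValHom)) (divZeroHom X.unop.K x)
    rw [divZeroHom, divZeroHom, MonoidHom.comp_apply, MonoidHom.comp_apply,
      divUnits_map f.unop.alg f.unop.isValHom, ← MonoidHom.comp_apply, realification_gp_square,
      MonoidHom.comp_apply]

/-- **Example 1.1 (i)** (FrdII p. 7): "this data determines a [model] Frobenioid `C₀`" — the category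
`C₀`, via the model-Frobenioid construction of [FrdI] Thm. 5.2 (i).
[cite: MochizukiFrdII2008, Ex 1.1 (i) p.7] -/
abbrev CZero : Type (u + 1) := ModelFrobenioid (phiZero.{u} p) (bZero p) (divZero p)

/-- An object of `C₀` over `Spec K`: "a metrized line bundle on `Spec(K)`" is given by its class
`α ∈ Φ₀(Spec K)^gp`; here the object with base `X` and class `α`. [cite: MochizukiFrdII2008, Ex 1.1 (i) p.8] -/
def CZero.mkObj (X : PadicFld.{u} p)
    (α : Algebra.GrothendieckGroup (Realification (OrdInt X.K))) : CZero p :=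
  ⟨X, α⟩

end Functors

end PadicFrd

end Literature.AlgebraicGeometry.Frobenioids
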